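import Mathlib.MeasureTheory.Integral.MeanInequalities
import Mathlib.Analysis.MeanInequalities
import Literature.Probability.LatticeModels.LatticeBlowUp
import HarnessLib

/-!
# The discrete Loomis–Whitney inequality and the sharp edge-isoperimetric inequality in `ℤ^d`

Topic `Literature/Probability/LatticeModels`. For a finite `A ⊆ ℤ^{n+1}` let `π_i A ⊆ ℤ^n` be its
projection forgetting the `i`-th coordinate (`dropCoord i A`, via `Fin.removeNth`). We prove

* `loomisWhitney` / `card_pow_le_prod_card_dropCoord` — **Loomis–Whitney (1949), discrete form**:
  `|A|^n ≤ ∏_{i=0}^{n} |π_i A|` for `A ⊆ ℤ^{n+1}`, `n ≥ 1` [LoomisWhitney1949, Theorem 2 (the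
  case of counting measure / unions of unit cubes)]. Proof: the classical induction on the
  dimension — slice `A` by its first coordinate into `A_t ⊆ ℤ^n`, apply the induction hypothesis
  to each slice, `|A_t| ≤ |π_0 A|`, `|π_{j+1} A| = Σ_t |π_j A_t|`, and the generalised Hölder
  inequality `Σ_t ∏_j f_j(t)^{1/(n+1)} ≤ ∏_j (Σ_t f_j(t))^{1/(n+1)}` (Mathlib's
  `ENNReal.lintegral_prod_norm_pow_le` for a finite sum of Dirac masses,
  `sum_prod_rpow_le_prod_sum_rpow`);
* `two_mul_sum_card_dropCoord_le_card_boundaryPairs` — every line of direction `eᵢ` meeting `A`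
  carries at least two boundary pairs of `A` (its two extreme points), so
  `2 Σ_i |π_i A| ≤ #(boundaryPairs A)`;
* `two_mul_card_mul_rpow_le_card_boundaryPairs` — with the AM–GM inequality, the **sharp
  edge-isoperimetric inequality `2d |A|^{(d-1)/d} ≤ #(boundaryPairs A)`** for finite non-empty
  `A ⊆ ℤ^d`, `d ≥ 1` (equality for cubes), improving the constant `2` of
  `two_mul_rpow_le_card_boundaryPairs` (`DiscreteIsoperimetry.lean`) to the optimal `2d`;
* `card_boundaryPairs_singleton` — `#(boundaryPairs {x}) = 2d`.

Used in `Literature/Probability/Percolation/AnchoredProfileAllOpenValue.lean` to identify the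
limit of the rescaled lattice isoperimetric profile (`isoConst d = 2d`).
-/

noncomputable section

open Finset MeasureTheory
open scoped ENNReal

namespace Literature.Probability.LatticeModels

variable {n : ℕ}

/-! ### Projections forgetting one coordinate -/

/-- The projection of `A ⊆ ℤ^{n+1}` forgetting the `i`-th coordinate. [cite: LoomisWhitney1949, Theorem 2 (the projections S_{x_i})] -/
def dropCoord (i : Fin (n + 1)) (A : Finset (Site (n + 1))) : Finset (Site n) :=
  A.image (Fin.removeNth i)

/-- Membership in a projection. [folklore] -/
theorem mem_dropCoord_iff {i : Fin (n + 1)} {A : Finset (Site (n + 1))} {w : Site n} :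
    w ∈ dropCoord i A ↔ ∃ x ∈ A, Fin.removeNth i x = w :=
  mem_image

/-- Forgetting the first coordinate is `dropFirst` of `DiscreteIsoperimetry.lean`. [folklore] -/
theorem dropCoord_zero_eq_dropFirst (A : Finset (Site (n + 1))) : dropCoord 0 A = dropFirst A := by
  ext w
  simp only [dropCoord, dropFirst, mem_image, Fin.removeNth_zero]

/-- Forgetting coordinate `j+1` of `(t, y)` is `(t, y without coordinate j)`. [folklore] -/
theorem removeNth_succ_cons (j : Fin (n + 1)) (t : ℤ) (y : Site (n + 1)) :
    Fin.removeNth j.succ (Fin.cons t y : Site (n + 2)) = Fin.cons t (Fin.removeNth j y) := by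
  funext k
  refine Fin.cases ?_ (fun l => ?_) k
  · simp [Fin.removeNth]
  · simp [Fin.removeNth]

/-- Forgetting coordinate `j+1` of `x` is `(x 0, tail x without coordinate j)`. [folklore] -/
theorem removeNth_succ (j : Fin (n + 1)) (x : Site (n + 2)) :
    Fin.removeNth j.succ x = Fin.cons (x 0) (Fin.removeNth j (Fin.tail x)) := by
  conv_lhs => rw [← Fin.cons_self_tail x]
  exact removeNth_succ_cons j (x 0) (Fin.tail x)

/-- **`|π_{j+1} A| = Σ_t |π_j A_t|`**: the projection forgetting coordinate `j+1` is the disjoint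
union over the first coordinate `t` of the projections of the slices. [folklore] -/
theorem card_dropCoord_succ (j : Fin (n + 1)) (A : Finset (Site (n + 2))) :
    #(dropCoord j.succ A) = ∑ t ∈ firstCoords A, #(dropCoord j (sliceAt A t)) := by
  classical
  have hunion : dropCoord j.succ A =
      (firstCoords A).biUnion fun t => (dropCoord j (sliceAt A t)).image (Fin.cons t) := by
    ext z
    simp only [mem_dropCoord_iff, mem_biUnion, mem_image]
    constructor
    · rintro ⟨x, hx, rfl⟩
      refine ⟨x 0, mem_image.2 ⟨x, hx, rfl⟩, Fin.removeNth j (Fin.tail x),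
        ⟨Fin.tail x, mem_sliceAt.2 (by rw [Fin.cons_self_tail]; exact hx), rfl⟩, ?_⟩
      rw [removeNth_succ]
    · rintro ⟨t, -, w, ⟨y, hy, rfl⟩, rfl⟩
      exact ⟨Fin.cons t y, mem_sliceAt.1 hy, removeNth_succ_cons j t y⟩
  rw [hunion, card_biUnion]
  · exact sum_congr rfl fun t _ =>
      card_image_of_injective _ ((Fin.cons_injective2 (α := fun _ : Fin (n + 1) => ℤ)).right t)
  · intro t _ t' _ htt'
    rw [Function.onFun, Finset.disjoint_left]
    intro z hz hz'
    obtain ⟨w, -, rfl⟩ := mem_image.1 hz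
    obtain ⟨w', -, h⟩ := mem_image.1 hz'
    have := congrFun h 0
    simp only [Fin.cons_zero] at this
    exact htt' this.symm

/-! ### The generalised Hölder inequality for finite sums -/

/-- **Generalised Hölder inequality for finite sums** (in `ℝ≥0∞`): if `Σ_{i ∈ s} p_i = 1`, `p_i ≥ 0`,
then `Σ_{t ∈ T} ∏_{i ∈ s} F_i(t)^{p_i} ≤ ∏_{i ∈ s} (Σ_{t ∈ T} F_i(t))^{p_i}` — Mathlib's
`ENNReal.lintegral_prod_norm_pow_le` for the measure `Σ_{t ∈ T} δ_t` on `ℤ`. [folklore] -/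
theorem sum_prod_rpow_le_prod_sum_rpow {ι : Type*} (s : Finset ι) (T : Finset ℤ)
    (F : ι → ℤ → ℝ≥0∞) {p : ι → ℝ} (hp : ∑ i ∈ s, p i = 1) (h2p : ∀ i ∈ s, 0 ≤ p i) :
    ∑ t ∈ T, ∏ i ∈ s, F i t ^ p i ≤ ∏ i ∈ s, (∑ t ∈ T, F i t) ^ p i := by
  have key := ENNReal.lintegral_prod_norm_pow_le (μ := ∑ t ∈ T, Measure.dirac t) s
    (f := F) (fun i _ => measurable_from_top.aemeasurable) hp h2p
  have h1 : ∀ g : ℤ → ℝ≥0∞, ∫⁻ a, g a ∂(∑ t ∈ T, Measure.dirac t) = ∑ t ∈ T, g t := fun g => by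
    rw [lintegral_finsetSum_measure]
    simp_rw [lintegral_dirac]
  simpa only [h1] using key

/-! ### The Loomis–Whitney inequality -/

/-- The case `n = 1` (`A ⊆ ℤ²`): `|A| ≤ |π_0 A| · |π_1 A|`, since `x ↦ (π_0 x, π_1 x)` is
injective. [cite: LoomisWhitney1949, Theorem 2 (case n = 2)] -/
theorem card_le_card_dropCoord_mul_two (A : Finset (Site 2)) : #A ≤ #(dropCoord 0 A) * #(dropCoord 1 A) := by
  classical
  rw [← card_product]
  refine card_le_card_of_injOn (fun x => (Fin.removeNth 0 x, Fin.removeNth 1 x)) ?_ ?_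
  · intro x hx
    rw [mem_coe, mem_product]
    exact ⟨mem_image_of_mem _ hx, mem_image_of_mem _ hx⟩
  · intro x _ x' _ h
    simp only [Prod.mk.injEq] at h
    obtain ⟨h0, h1⟩ := h
    have hx1 : x 1 = x' 1 := by
      have := congrFun h0 0
      simpa [Fin.removeNth] using this
    have hx0 : x 0 = x' 0 := by
      have := congrFun h1 0
      simpa [Fin.removeNth] using this
    funext k
    refine Fin.cases hx0 (fun l => ?_) k
    rw [Fin.eq_zero l]
    exact hx1

/-- **The Loomis–Whitney inequality, discrete form, in `ℝ≥0∞`**: `|A|^n ≤ ∏_{i} |π_i A|` for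
finite `A ⊆ ℤ^{n+1}`, `n ≥ 1` (induction on `n` by slicing and the generalised Hölder
inequality). [cite: LoomisWhitney1949, Theorem 2] -/
theorem loomisWhitney : ∀ n : ℕ, 1 ≤ n → ∀ A : Finset (Site (n + 1)),
    ((#A : ℝ≥0∞)) ^ n ≤ ∏ i : Fin (n + 1), (#(dropCoord i A) : ℝ≥0∞) := by
  intro n hn
  induction n, hn using Nat.le_induction with
  | base =>
    intro A
    rw [pow_one, Fin.prod_univ_two]
    exact_mod_cast card_le_card_dropCoord_mul_two A
  | succ n hn ih =>
    intro A
    classical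
    -- exponent `q = 1/(n+1)`
    obtain ⟨q, hq⟩ : ∃ q : ℝ, q = ((n : ℝ) + 1)⁻¹ := ⟨_, rfl⟩
    have hq0 : 0 ≤ q := by rw [hq]; positivity
    have hn1 : (0 : ℝ) < (n : ℝ) + 1 := by positivity
    have hqsum : ∑ _j : Fin (n + 1), q = 1 := by
      rw [sum_const, card_univ, Fintype.card_fin, nsmul_eq_mul, hq, Nat.cast_succ,
        mul_inv_cancel₀ hn1.ne']
    have hq1 : q + n * q = 1 := by
      rw [hq]
      field_simp
      ring
    -- Step 1: each slice
    have hslice : ∀ t ∈ firstCoords A, (#(sliceAt A t) : ℝ≥0∞) ≤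
        (#(dropCoord 0 A) : ℝ≥0∞) ^ q * ∏ j : Fin (n + 1), (#(dropCoord j (sliceAt A t)) : ℝ≥0∞) ^ q := by
      intro t _
      have hsplit : (#(sliceAt A t) : ℝ≥0∞) =
          (#(sliceAt A t) : ℝ≥0∞) ^ q * ((#(sliceAt A t) : ℝ≥0∞) ^ n) ^ q := by
        conv_lhs => rw [← ENNReal.rpow_one (#(sliceAt A t) : ℝ≥0∞), ← hq1]
        rw [ENNReal.rpow_add_of_nonneg _ _ hq0 (mul_nonneg (Nat.cast_nonneg n) hq0),
          ENNReal.rpow_mul, ENNReal.rpow_natCast]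
      have h0 : (#(sliceAt A t) : ℝ≥0∞) ≤ #(dropCoord 0 A) := by
        rw [dropCoord_zero_eq_dropFirst]
        exact_mod_cast card_le_card (sliceAt_subset_dropFirst t)
      have hih : (#(sliceAt A t) : ℝ≥0∞) ^ n ≤ ∏ j : Fin (n + 1), (#(dropCoord j (sliceAt A t)) : ℝ≥0∞) :=
        ih (sliceAt A t)
      rw [hsplit, ENNReal.prod_rpow_of_nonneg hq0]
      exact mul_le_mul' (ENNReal.rpow_le_rpow h0 hq0) (ENNReal.rpow_le_rpow hih hq0)
    -- Step 2: sum over the slices and Hölder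
    have hA : (#A : ℝ≥0∞) = ∑ t ∈ firstCoords A, (#(sliceAt A t) : ℝ≥0∞) := by
      exact_mod_cast card_eq_sum_card_sliceAt (A := A)
    have hH := sum_prod_rpow_le_prod_sum_rpow (univ : Finset (Fin (n + 1))) (firstCoords A)
      (fun j t => (#(dropCoord j (sliceAt A t)) : ℝ≥0∞)) hqsum (fun _ _ => hq0)
    have hproj : ∀ j : Fin (n + 1),
        ∑ t ∈ firstCoords A, (#(dropCoord j (sliceAt A t)) : ℝ≥0∞) = #(dropCoord j.succ A) := fun j => by
      exact_mod_cast (card_dropCoord_succ j A).symm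
    simp only [hproj] at hH
    have hle : (#A : ℝ≥0∞) ≤ (∏ i : Fin (n + 2), (#(dropCoord i A) : ℝ≥0∞)) ^ q := by
      calc (#A : ℝ≥0∞) = ∑ t ∈ firstCoords A, (#(sliceAt A t) : ℝ≥0∞) := hA
        _ ≤ ∑ t ∈ firstCoords A, (#(dropCoord 0 A) : ℝ≥0∞) ^ q *
              ∏ j : Fin (n + 1), (#(dropCoord j (sliceAt A t)) : ℝ≥0∞) ^ q := sum_le_sum hslice
        _ = (#(dropCoord 0 A) : ℝ≥0∞) ^ q *
              ∑ t ∈ firstCoords A, ∏ j : Fin (n + 1), (#(dropCoord j (sliceAt A t)) : ℝ≥0∞) ^ q := by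
            rw [mul_sum]
        _ ≤ (#(dropCoord 0 A) : ℝ≥0∞) ^ q * ∏ j : Fin (n + 1), (#(dropCoord j.succ A) : ℝ≥0∞) ^ q :=
            mul_le_mul' le_rfl hH
        _ = (∏ i : Fin (n + 2), (#(dropCoord i A) : ℝ≥0∞)) ^ q := by
            have hsucc : ∏ i : Fin (n + 2), (#(dropCoord i A) : ℝ≥0∞) =
                (#(dropCoord 0 A) : ℝ≥0∞) * ∏ j : Fin (n + 1), (#(dropCoord j.succ A) : ℝ≥0∞) :=
              Fin.prod_univ_succ _
            rw [hsucc, ENNReal.mul_rpow_of_nonneg _ _ hq0, ← ENNReal.prod_rpow_of_nonneg hq0]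
    -- Step 3: raise to the power `n+1`
    rw [hq] at hle
    have key := (ENNReal.le_rpow_inv_iff hn1).1 hle
    have h2 : ((n + 1 : ℕ) : ℝ) = (n : ℝ) + 1 := Nat.cast_succ n
    rw [← ENNReal.rpow_natCast, h2]
    exact key

/-- **The Loomis–Whitney inequality, discrete form**: `|A|^n ≤ ∏_{i=0}^{n} |π_i A|` for finite
`A ⊆ ℤ^{n+1}`, `n ≥ 1`. [cite: LoomisWhitney1949, Theorem 2] -/
theorem card_pow_le_prod_card_dropCoord (hn : 1 ≤ n) (A : Finset (Site (n + 1))) :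
    #A ^ n ≤ ∏ i : Fin (n + 1), #(dropCoord i A) := by
  exact_mod_cast loomisWhitney n hn A

/-! ### From projections to boundary pairs -/

/-- Each line of direction `± eᵢ` meeting `A` carries a boundary pair of `A` in that direction (its
extreme point): `|π_i A| ≤ #{boundary pairs of A with direction (i, b)}`. [folklore] -/
theorem card_dropCoord_le_card_filter_boundaryPairs (i : Fin (n + 1)) (b : Bool)
    (A : Finset (Site (n + 1))) :
    #(dropCoord i A) ≤ #{t ∈ boundaryPairs A | t.2 = (i, b)} := by
  classical
  refine card_le_card_of_surjOn (fun t => Fin.removeNth i t.1) ?_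
  intro w hw
  rw [mem_coe, mem_dropCoord_iff] at hw
  obtain ⟨x₀, hx₀, rfl⟩ := hw
  -- the fibre of the line through `x₀`
  set F := A.filter (fun x => Fin.removeNth i x = Fin.removeNth i x₀) with hF
  have hFne : F.Nonempty := ⟨x₀, by simp [hF, hx₀]⟩
  -- moving along `± eᵢ` does not change the projection
  have hstep : ∀ (x : Site (n + 1)) (b' : Bool),
      Fin.removeNth i (x + unitStep i b') = Fin.removeNth i x := fun x b' => by
    funext l
    simp only [Fin.removeNth, Pi.add_apply, unitStep_apply, if_neg (Fin.succAbove_ne i l),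
      add_zero]
  cases b with
  | true =>
    obtain ⟨x, hxF, hmax⟩ := F.exists_max_image (fun x => x i) hFne
    rw [hF, mem_filter] at hxF
    refine ⟨(x, i, true), ?_, hxF.2⟩
    rw [mem_coe, mem_filter, mem_boundaryPairs]
    refine ⟨⟨hxF.1, fun hx' => ?_⟩, rfl⟩
    have hmem : x + unitStep i true ∈ F := by
      rw [hF, mem_filter]
      exact ⟨hx', by rw [hstep, hxF.2]⟩
    have h := hmax _ hmem
    simp only [Pi.add_apply, unitStep_apply, if_true] at h
    linarith
  | false =>
    obtain ⟨x, hxF, hmin⟩ := F.exists_min_image (fun x => x i) hFne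
    rw [hF, mem_filter] at hxF
    refine ⟨(x, i, false), ?_, hxF.2⟩
    rw [mem_coe, mem_filter, mem_boundaryPairs]
    refine ⟨⟨hxF.1, fun hx' => ?_⟩, rfl⟩
    have hmem : x + unitStep i false ∈ F := by
      rw [hF, mem_filter]
      exact ⟨hx', by rw [hstep, hxF.2]⟩
    have h := hmin _ hmem
    simp only [Pi.add_apply, unitStep_apply, if_true, Bool.false_eq_true, if_false] at h
    linarith

/-- **`2 Σ_i |π_i A| ≤ #(boundaryPairs A)`**: the boundary pairs split according to their `2(n+1)`
directions, and each direction `(i, ±)` has at least `|π_i A|` of them. [folklore] -/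
theorem two_mul_sum_card_dropCoord_le_card_boundaryPairs (A : Finset (Site (n + 1))) :
    2 * ∑ i : Fin (n + 1), #(dropCoord i A) ≤ #(boundaryPairs A) := by
  classical
  have hdecomp : #(boundaryPairs A) =
      ∑ c : Fin (n + 1) × Bool, #{t ∈ boundaryPairs A | t.2 = c} :=
    card_eq_sum_card_fiberwise fun t _ => mem_coe.2 (mem_univ t.2)
  rw [hdecomp, Fintype.sum_prod_type, mul_sum]
  refine sum_le_sum fun i _ => ?_
  rw [Fintype.sum_bool, two_mul]
  exact add_le_add (card_dropCoord_le_card_filter_boundaryPairs i true A)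
    (card_dropCoord_le_card_filter_boundaryPairs i false A)

/-! ### The sharp edge-isoperimetric inequality -/

/-- The sharp inequality in dimension `n + 1 ≥ 2`: `2(n+1) |A|^{n/(n+1)} ≤ #(boundaryPairs A)`
(Loomis–Whitney and the AM–GM inequality). [cite: LoomisWhitney1949, Theorem 2 (isoperimetric corollary)] -/
theorem two_mul_succ_mul_rpow_le_card_boundaryPairs (hn : 1 ≤ n) (A : Finset (Site (n + 1))) :
    2 * ((n : ℝ) + 1) * (#A : ℝ) ^ ((n : ℝ) / ((n : ℝ) + 1)) ≤ #(boundaryPairs A) := by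
  have hn1 : (0 : ℝ) < (n : ℝ) + 1 := by positivity
  have hP0 : ∀ i : Fin (n + 1), (0 : ℝ) ≤ #(dropCoord i A) := fun i => by positivity
  -- AM–GM: `∏ P_i^{1/(n+1)} ≤ Σ P_i / (n+1)`
  have hamgm := Real.geom_mean_le_arith_mean_weighted (univ : Finset (Fin (n + 1)))
    (fun _ => ((n : ℝ) + 1)⁻¹) (fun i => (#(dropCoord i A) : ℝ)) (fun _ _ => by positivity)
    (by rw [sum_const, card_univ, Fintype.card_fin, nsmul_eq_mul, Nat.cast_succ,
      mul_inv_cancel₀ hn1.ne'])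
    (fun i _ => hP0 i)
  rw [Real.finsetProd_rpow _ _ (fun i _ => hP0 i), ← mul_sum] at hamgm
  -- Loomis–Whitney: `|A|^n ≤ ∏ P_i`, so `|A|^{n/(n+1)} ≤ (∏ P_i)^{1/(n+1)}`
  have hLW : (#A : ℝ) ^ n ≤ ∏ i : Fin (n + 1), (#(dropCoord i A) : ℝ) := by
    exact_mod_cast card_pow_le_prod_card_dropCoord hn A
  have hroot : (#A : ℝ) ^ ((n : ℝ) / ((n : ℝ) + 1)) ≤
      (∏ i : Fin (n + 1), (#(dropCoord i A) : ℝ)) ^ (((n : ℝ) + 1)⁻¹) := by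
    rw [div_eq_mul_inv, Real.rpow_mul (by positivity), Real.rpow_natCast]
    exact Real.rpow_le_rpow (by positivity) hLW (by positivity)
  -- boundary pairs: `2 Σ P_i ≤ #∂A`
  have hbp : 2 * ∑ i : Fin (n + 1), (#(dropCoord i A) : ℝ) ≤ #(boundaryPairs A) := by
    exact_mod_cast two_mul_sum_card_dropCoord_le_card_boundaryPairs A
  calc 2 * ((n : ℝ) + 1) * (#A : ℝ) ^ ((n : ℝ) / ((n : ℝ) + 1))
      ≤ 2 * ((n : ℝ) + 1) * (∏ i : Fin (n + 1), (#(dropCoord i A) : ℝ)) ^ (((n : ℝ) + 1)⁻¹) := by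
        gcongr
    _ ≤ 2 * ((n : ℝ) + 1) * (((n : ℝ) + 1)⁻¹ * ∑ i : Fin (n + 1), (#(dropCoord i A) : ℝ)) := by
        gcongr
    _ = 2 * ∑ i : Fin (n + 1), (#(dropCoord i A) : ℝ) := by field_simp
    _ ≤ #(boundaryPairs A) := hbp

/-- **The sharp edge-isoperimetric inequality in `ℤ^d`**: for `d ≥ 1` and finite non-empty
`A ⊆ ℤ^d`, `2d |A|^{(d-1)/d} ≤ #(boundaryPairs A)` (equality for cubes `[0, k)^d`); the optimal
form of `two_mul_rpow_le_card_boundaryPairs` of `DiscreteIsoperimetry.lean`.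
[cite: LoomisWhitney1949, Theorem 2 (isoperimetric corollary)] -/
theorem two_mul_card_mul_rpow_le_card_boundaryPairs {d : ℕ} (hd : 1 ≤ d) (A : Finset (Site d))
    (hA : A.Nonempty) : 2 * d * (#A : ℝ) ^ (((d : ℝ) - 1) / d) ≤ #(boundaryPairs A) := by
  obtain ⟨n, rfl⟩ : ∃ n, d = n + 1 := ⟨d - 1, by omega⟩
  rcases Nat.eq_zero_or_pos n with rfl | hn
  · have h := two_le_card_boundaryPairs_one A hA
    have h' : (2 : ℝ) ≤ #(boundaryPairs A) := by exact_mod_cast h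
    simpa using h'
  · have h := two_mul_succ_mul_rpow_le_card_boundaryPairs hn A
    have h2 : ((n + 1 : ℕ) : ℝ) = (n : ℝ) + 1 := Nat.cast_succ n
    have hexp : (n : ℝ) / ((n : ℝ) + 1) = (((n + 1 : ℕ) : ℝ) - 1) / ((n + 1 : ℕ) : ℝ) := by
      rw [h2]; ring
    rw [hexp, ← h2] at h
    exact h

/-- A single site has `2d` boundary pairs (all `2d` directions leave `{x}`). [folklore] -/
theorem card_boundaryPairs_singleton {d : ℕ} (x : Site d) : #(boundaryPairs {x}) = 2 * d := by
  classical
  have h : boundaryPairs ({x} : Finset (Site d)) = {x} ×ˢ univ := by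
    rw [boundaryPairs, filter_true_of_mem]
    intro t ht
    rw [mem_product, mem_singleton] at ht
    rw [ht.1, mem_singleton]
    intro h
    exact unitStep_ne_zero t.2.1 t.2.2 (by simpa using h)
  rw [h, card_product, card_singleton, card_univ, Fintype.card_prod, Fintype.card_fin,
    Fintype.card_bool]
  ring

end Literature.Probability.LatticeModels

end
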